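import Mathlib
import HarnessLib
import Summits.AtomisticToContinuum.Crystallization.Theorems.PricedLinkCensusSoftLayerPropagationStubBallPropagationLayers

/-!
# Local layer-propagation lemmas for the finite-ball form of Hales, *Dense Sphere Packings* §1.3 (VII):
# frames at a centre, transport of the ball hypothesis, the nearest centre of a layer

Route `PricedLinkCensus`, crux `SoftLayerPropagation` (stmt-AtomisticToContinuum-14233), line
`Sketch`, seventh helper file for the stub `stub_ballPropagation` (frame `u₁, u₂, w, 𝗁 e₃` of
`LayerShells.lean`; uses `…StubBallPropagationLayers.lean`).  The normalisations with which a
layer-by-layer reconstruction of the packing on a ball begins: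

* `exists_frame_of_hcp_centre` / `exists_frame_of_fcc_centre` — at a centre `q` whose shell is an
  HCP (resp. FCC) pattern there is a linear isometry `L` such that the moved packing
  `{x | q + L x ∈ V}` has, at the origin, the shell `layerShell s s` (resp. `layerShell σ (−σ)`)
  (local forms of the two halves of `exists_frame_layer_subset`: the pattern is assumed at `q` only;
  an FCC shell is centrally symmetric and an HCP shell is not, which sorts the types);
* `isArrangedIn_preimage_of_ball` — the ball hypothesis "every centre within `R` of `u` has a
  pattern shell" passes to the moved packing with centre `L⁻¹ (u − q)` (`kissingShell_preimage`,
  `IsArrangedIn.preimage`), together with the packing property (`IsUnitBallPacking.preimage`);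
* `sq_add_sq_le_of_forall_hexagon` — if none of the six hexagon neighbours `η` of the origin is
  closer to a point `x` than the origin is, up to `1/3` in squared distance
  (`‖η − x‖² ≥ ‖x‖² − 1/3`), then the horizontal part of `x` has squared norm `≤ 169/108 < 2`
  (`sq_add_sq_le_of_hexagon_bounds` scaled by `13/12`): the foot of the ball's centre on the base
  layer lies within `√2` of an (almost) nearest lattice centre, the seed condition of the disc
  induction (`…StubBallPropagationDisc.lean`), with the slack `1/3` that lets "nearest" be chosen by
  minimising the natural number `⌊3 · dist²⌋` instead of by a finiteness argument.

All statements are elementary ([folklore]).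
-/

noncomputable section

namespace Summit.AtomisticToContinuum.Crystallization.Theorems

open Literature.Geometry.DiscreteGeometry Literature.MathematicalPhysics.StatisticalMechanics
open RealInnerProductSpace

/-! ### Frames at a centre -/

/-- **A frame at an HCP centre.**  If the shell of the centre `q` of the packing `V` is an HCP
pattern, then for some linear isometry `L` of `ℝ³` and some sign `s` the moved packing
`{x | q + L x ∈ V}` has shell `layerShell s s` at the origin (its mirror hexagon moved onto the
standard hexagon; the type is `(s, s)` because an HCP shell is not centrally symmetric).
[cite: HalesDSP2012, §1.3] -/
theorem exists_frame_of_hcp_centre {V : Set (EuclideanSpace ℝ (Fin 3))} (hV : IsUnitBallPacking V)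
    {q : EuclideanSpace ℝ (Fin 3)}
    (harr : IsArrangedIn (kissingShell V q) hcpKissingPattern) :
    ∃ L : EuclideanSpace ℝ (Fin 3) ≃ₗᵢ[ℝ] EuclideanSpace ℝ (Fin 3), ∃ s : ℝ, (s = 1 ∨ s = -1) ∧
      kissingShell {x | q + L x ∈ V} 0 = layerShell s s := by
  -- adapted from `exists_frame_layer_subset` (LayerPropagation.lean), first half
  obtain ⟨L, hH, hns⟩ := exists_frame_of_isArrangedIn_hcp harr
  have hV' := hV.preimage q L
  have hS0 : kissingShell {x | q + L x ∈ V} 0 = L ⁻¹' kissingShell V q := by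
    rw [kissingShell_preimage]; simp
  have harr' : IsArrangedIn (kissingShell {x | q + L x ∈ V} 0) hcpKissingPattern := by
    rw [hS0]; exact harr.preimage L
  obtain ⟨σ, σ', hσ, hσ', hST⟩ :=
    (isTwelveConfig_kissingShell_of_isArrangedIn hV' (Or.inr harr')).eq_layerShell (hS0 ▸ hH)
  have hσσ : σ' = σ := layerShell_types_eq_of_not_symmetric hσ hσ' (by rwa [← hST, hS0])
  subst hσσ
  exact ⟨L, σ', hσ, hST⟩

/-- An FCC-arranged set is not HCP-arranged (the first is centrally symmetric, the second is not).
[folklore] -/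
theorem not_isArrangedIn_hcp_of_fcc {T : Set (EuclideanSpace ℝ (Fin 3))}
    (hfcc : IsArrangedIn T fccKissingPattern) : ¬ IsArrangedIn T hcpKissingPattern := by
  intro hhcp
  obtain ⟨A, hA⟩ := isArrangedIn_fcc_iff_range.1 hfcc
  obtain ⟨B, hB⟩ := isArrangedIn_hcp_iff_range.1 hhcp
  exact not_centrallySymmetric_of_hcp_range hB fun x hx => neg_mem_of_fcc_range hA hx

/-- **A frame at an FCC centre.**  If the shell of the centre `q` is an FCC pattern, then for some
linear isometry `L` and sign `σ` the moved packing `{x | q + L x ∈ V}` has shell `layerShell σ (−σ)`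
at the origin (one of its four hexagons moved onto the standard hexagon; the type is `(σ, −σ)`
because `layerShell σ σ` is HCP-arranged and an FCC shell is not). [cite: HalesDSP2012, §1.3] -/
theorem exists_frame_of_fcc_centre {V : Set (EuclideanSpace ℝ (Fin 3))} (hV : IsUnitBallPacking V)
    {q : EuclideanSpace ℝ (Fin 3)}
    (harr : IsArrangedIn (kissingShell V q) fccKissingPattern) :
    ∃ L : EuclideanSpace ℝ (Fin 3) ≃ₗᵢ[ℝ] EuclideanSpace ℝ (Fin 3), ∃ σ : ℝ, (σ = 1 ∨ σ = -1) ∧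
      kissingShell {x | q + L x ∈ V} 0 = layerShell σ (-σ) := by
  obtain ⟨L, hH⟩ := exists_frame_of_isArrangedIn_fcc harr
  have hV' := hV.preimage q L
  have hS0 : kissingShell {x | q + L x ∈ V} 0 = L ⁻¹' kissingShell V q := by
    rw [kissingShell_preimage]; simp
  have harr' : IsArrangedIn (kissingShell {x | q + L x ∈ V} 0) fccKissingPattern := by
    rw [hS0]; exact harr.preimage L
  obtain ⟨σ, σ', hσ, hσ', hST⟩ :=
    (isTwelveConfig_kissingShell_of_isArrangedIn hV' (Or.inl harr')).eq_layerShell (hS0 ▸ hH)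
  have hσσ : σ' = -σ := by
    by_contra hne
    have : σ' = σ := by
      rcases hσ with rfl | rfl <;> rcases hσ' with rfl | rfl <;> first | rfl | (exfalso; exact hne (by norm_num))
    subst this
    exact not_isArrangedIn_hcp_of_fcc harr' (hST ▸ isArrangedIn_layerShell_hcp' hσ)
  subst hσσ
  exact ⟨L, σ, hσ, hST⟩

/-! ### Transport of the ball hypothesis -/

/-- **The ball hypothesis in the frame.**  If every centre of `V` within distance `R` of `u` has a
pattern shell, then every centre of the moved packing `{x | q + L x ∈ V}` within `R` of the moved
centre `L⁻¹ (u − q)` has a pattern shell. [folklore] -/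
theorem isArrangedIn_preimage_of_ball {V : Set (EuclideanSpace ℝ (Fin 3))}
    {u : EuclideanSpace ℝ (Fin 3)} {R : ℝ}
    (hpat : ∀ v ∈ V, dist u v ≤ R →
      IsArrangedIn (kissingShell V v) fccKissingPattern ∨ IsArrangedIn (kissingShell V v) hcpKissingPattern)
    (q : EuclideanSpace ℝ (Fin 3)) (L : EuclideanSpace ℝ (Fin 3) ≃ₗᵢ[ℝ] EuclideanSpace ℝ (Fin 3)) :
    ∀ x ∈ {x | q + L x ∈ V}, dist x (L.symm (u - q)) ≤ R →
      IsArrangedIn (kissingShell {x | q + L x ∈ V} x) fccKissingPattern ∨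
        IsArrangedIn (kissingShell {x | q + L x ∈ V} x) hcpKissingPattern := by
  intro x hx hd
  have hd' : dist u (q + L x) ≤ R := by
    have e : dist x (L.symm (u - q)) = dist (q + L x) u := by
      rw [← L.dist_map, LinearIsometryEquiv.apply_symm_apply, ← dist_add_left q, add_sub_cancel]
    rw [dist_comm, ← e]; exact hd
  rw [kissingShell_preimage]
  rcases hpat _ hx hd' with h | h
  · exact Or.inl (h.preimage L)
  · exact Or.inr (h.preimage L)

/-- In the frame the original centre `q` is the origin, and it is within `R` of the moved centre as
soon as `dist u q ≤ R`. [folklore] -/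
theorem dist_zero_symm_sub_eq {u q : EuclideanSpace ℝ (Fin 3)}
    (L : EuclideanSpace ℝ (Fin 3) ≃ₗᵢ[ℝ] EuclideanSpace ℝ (Fin 3)) :
    dist (0 : EuclideanSpace ℝ (Fin 3)) (L.symm (u - q)) = dist u q := by
  rw [← L.dist_map, map_zero, LinearIsometryEquiv.apply_symm_apply, dist_comm, dist_eq_norm,
    dist_eq_norm, sub_zero]

/-! ### The foot of the ball's centre on the base layer -/

/-- **Almost-nearest lattice centre.**  If none of the six hexagon neighbours `η` of the origin is
closer to the point `x` than the origin by more than `1/3` in squared distance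
(`‖x‖² − 1/3 ≤ ‖η − x‖²`), then `⟪x, η⟫ ≤ 13/6` for the six `η`, and the horizontal part of `x`
satisfies `x₀² + x₁² ≤ 169/108` (`sq_add_sq_le_of_hexagon_bounds` applied to `12x/13`); in
particular `≤ 2`, the seed condition of the disc induction. [folklore] -/
theorem sq_add_sq_le_of_forall_hexagon {x : EuclideanSpace ℝ (Fin 3)}
    (h : ∀ η ∈ hexagonSet, ‖x‖ ^ 2 - 1 / 3 ≤ ‖η - x‖ ^ 2) : x 0 ^ 2 + x 1 ^ 2 ≤ 169 / 108 := by
  have key : ∀ η ∈ hexagonSet, ⟪x, η⟫ ≤ 13 / 6 := fun η hη => by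
    have h1 := h η hη
    have hη : ‖η‖ = 2 := norm_of_mem_hexagonSet hη
    rw [norm_sub_sq_real, hη, real_inner_comm] at h1
    linarith
  have k1 := key _ (by simp [hexagonSet] : triangularVec₁ 2 ∈ hexagonSet)
  have k2 := key _ (by simp [hexagonSet] : -triangularVec₁ 2 ∈ hexagonSet)
  have k3 := key _ (by simp [hexagonSet] : triangularVec₂ 2 ∈ hexagonSet)
  have k4 := key _ (by simp [hexagonSet] : -triangularVec₂ 2 ∈ hexagonSet)
  have k5 := key _ (by simp [hexagonSet] : triangularVec₁ 2 - triangularVec₂ 2 ∈ hexagonSet)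
  have k6 := key _ (by simp [hexagonSet] : triangularVec₂ 2 - triangularVec₁ 2 ∈ hexagonSet)
  simp only [inner_neg_right, inner_sub_right, inner_fin3, frameU_apply_zero, frameU_apply_one,
    frameU_apply_two, frameV_apply_zero, frameV_apply_one, frameV_apply_two, mul_zero, add_zero,
    mul_one] at k1 k2 k3 k4 k5 k6
  have hsq := sq_add_sq_le_of_hexagon_bounds (a := 12 / 13 * x 0) (b := 12 / 13 * x 1) (by linarith)
    (by linarith) (by linarith) (by linarith) (by linarith) (by linarith)
  nlinarith [hsq]

/-- The same conclusion in the form used downstream: `x₀² + x₁² ≤ 2`. [folklore] -/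
theorem sq_add_sq_le_two_of_forall_hexagon {x : EuclideanSpace ℝ (Fin 3)}
    (h : ∀ η ∈ hexagonSet, ‖x‖ ^ 2 - 1 / 3 ≤ ‖η - x‖ ^ 2) : x 0 ^ 2 + x 1 ^ 2 ≤ 2 :=
  (sq_add_sq_le_of_forall_hexagon h).trans (by norm_num)

/-- **Registered sub-goal `ballPropagation_frameOfHcpCentre`** of the crux item (the frame at an
HCP centre, in closed form): `exists_frame_of_hcp_centre`. [folklore] -/
theorem ballPropagation_frameOfHcpCentre :
    ∀ (V : Set (EuclideanSpace ℝ (Fin 3))), Literature.Geometry.DiscreteGeometry.IsUnitBallPacking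
    V → ∀ (q : EuclideanSpace ℝ (Fin 3)), Literature.Geometry.DiscreteGeometry.IsArrangedIn
    (Literature.Geometry.DiscreteGeometry.kissingShell V q)
    Literature.Geometry.DiscreteGeometry.hcpKissingPattern → ∃ L : EuclideanSpace ℝ (Fin 3) ≃ₗᵢ[ℝ]
    EuclideanSpace ℝ (Fin 3), ∃ s : ℝ, (s = 1 ∨ s = -1) ∧
    Literature.Geometry.DiscreteGeometry.kissingShell {x | q + L x ∈ V} 0 =
    Literature.Geometry.DiscreteGeometry.layerShell s s :=
  fun _ hV _ harr => exists_frame_of_hcp_centre hV harr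

end Summit.AtomisticToContinuum.Crystallization.Theorems

end
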